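import Summits.QuantumFields.YangMills.Theorems.BalabanUVNodesN15TwoSpacingGluingCurvedKnitSmallField
import Summits.QuantumFields.YangMills.Theorems.BalabanUVNodesN15CovariantAveragingLetters
import Summits.QuantumFields.YangMills.Theorems.BalabanUVNodesN15BackgroundDressedInverse
import HarnessLib

/-!
# THE GLUING STEP AT TWO LATTICE SPACINGS — PROGRAMME (P-Q), III: THE LIVE-`U` KNIT AT THE COVER WITH BAŁABAN's COVARIANT AVERAGING SUMMAND `a·Q*(U)Q(U)` LIVE —
# the glued inverse of `Δ_{Ad e^{iηA}} + a·Q*(U)Q(U) − ∂Π∂* ⊗ 1_ι` in the global small-field gauge, every row of FILE 120 PRODUCED (dag-n15-c g21, n15-c∕183; N15 = NE2, s1)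

Cell `pub-ymgap`, seat `pub-ymgap-dag-n15-c` (R134 (a); HUMAN RULING D-0062), generation 21.  `bears_on: R4∕N15 · K3⁸ SpineGivenEndpointR13SepCoPHV (stmt-QuantumFields-27366)`.
Filed `--supports stmt-QuantumFields-27366 --as helper` — COUNT-NEUTRAL.  Two plumbing `def`s (`cvT`, `cvNVq`) + theorems; 0 `sorry`.  Imports BY NAME FILE 129 `…CurvedKnitSmallField`
(through it FILE 120 `uN_cvGlued_spec`, `fluct_mem_unitaryGroup_of_isHermitian`, `gaugeTr_one`, `mmulOp_coordMat_conj_one(_transpose)`, `sf_localCoefLetters`; dag-n15-w2 `uN_opLetters_of_gauge335`,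
`uN_abs_coordMat_conj_sub_one_entry_le_op`), n15-c∕182b `…CovariantAveragingLetters` (★★ `hasMaj_nvQ`; through it n15-c∕181 `qvCov`∕`qvCovAdj`∕`qvCov_one`∕`qvCovAdj_one`) and n15-c g8
`…BackgroundDressedInverse` (`tensorId_add`, `tensorId_smul`).  Nothing in the
tree is modified, no landed name re-declared.

WHY (the lane's LOCATED (P); ref-B READ-989 item (b)(i) «the model's nonlocal part is FLAT ((1.69)-type), not (3.26)»).  FILE 129 (`sf_cvGlued_spec`) produced every row of the cover knit for
the summand `P := N_L ⊗ 1_ι = (aQ*Q − ∂Π∂*) ⊗ 1_ι` — Bałaban's `P(U) = Q*(U)aQ(U) + D_U R(U) D*_U` ([Balaban1985BackgroundPropagators] (3.26) p. 395) read at `U ≡ 1`.  THIS FILE makes the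
AVERAGING summand LIVE: `P := a·Q*(U)Q(U) − ∂Π∂* ⊗ 1_ι` with `Q(U)` the covariant block-line averaging of n15-c∕181 (main term (125) of [Balaban1985Averaging] (124), transporters
`Ad_{e^{iηA}}` in trace-form coordinates), in the same global small-field gauge (`w ≡ 1`, Hermitian `A` with the (3.35) letters `‖A_μ(x)‖ < C∕ξ`, `‖η⁻¹∇^ηA‖ < C∕ξ²` everywhere).  The
perturbation is `N_V^Q = N_L ⊗ 1 − P = a(Q*Q ⊗ 1 − Q*(U)Q(U))` (the Landau parts cancel): block-local and `O(a·(e^{2(d+2)|ι|κ_e·2m·(C∕ξ)e^{ηC∕ξ}} − 1))` by n15-c∕182b `hasMaj_nvQ` once each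
transporter is `ρ`-close to `1` (`ρ = |ι|·κ_e·2√m·√m·η(C∕ξ)e^{ηC∕ξ}`, dag-n15-w2's entry letter + `‖e^{iηA} − 1‖ ≤ η(C∕ξ)e^{ηC∕ξ}`), so 120's rows `hNVcut`∕`hfarN` hold with `R_N = θ_F = R₁·K`,
`K = (1+ρ)^{(d+2)L^k} − 1`, and 120 applies: decay + two-sided inverse of the glued operator of `Δ_{Ad e^{iηA}} + a·Q*(U)Q(U) − ∂Π∂* ⊗ 1_ι`.

WHAT.
* §1 `cvT e U` (the transporter datum `coordMat e Ad_{U_μ(p)}`), ★ `cvNVq` (`N_V^Q := a·(tensorId ι (Q*∘Q) − Q*_{T}∘Q_{T})`, `T = cvT e U`) (`tensorId_add`∕`_smul` are n15-c g8's, imported),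
  ★ `cvNL_sub_cvNVq` (THE SUMMAND: `N_L ⊗ 1 − N_V^Q = a·Q*(U)∘Q(U) + (−∂Π∂*) ⊗ 1_ι`), `conj_one_cvNL_sub_cvNVq` (120's `hP` at `w ≡ 1`), `hasMaj_sandwich_of_abs_le_one` (`M_ψ∘N∘M_χ` keeps a
  nonnegative majorant when `|ψ|, |χ| ≤ 1`).
* §2 ★ `sf_rows_cvT_sub_one_le` ∕ ★ `sf_cols_cvT_sub_one_le`: in the global gauge the transporters of `e^{iηA}` are `ρ`-close to `1` in rows AND columns, `ρ = |ι|·κ_e·2√m·(√m·η(C∕ξ)e^{ηC∕ξ})`.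
* §3 ★★★ **`sfq_cvGlued_spec`** — FILE 120 with `w ≡ 1`, `U := e^{iηA}`, `P := N_L ⊗ 1 − N_V^Q`, `N_V := N_V^Q`: `∃ δ w₀ R₀ R₁ B > 0`, for every cover index (`k ≥ 1`, `L^m ≥ w₀`), trace-form `e`,
  Hermitian `A` in the global (3.35) class with the two row bounds `≤ r_V`, `K ≤ 1` and `r_V(1 + |J ⊕ J|) + R₁K ≤ R₀`: the glued operator is `≤ B·e^{−(δ∕16)d}` blockwise AND the two-sided
  inverse of `Δ_{Ad e^{iηA}} + (N_L ⊗ 1 − N_V^Q)`.  No displayed row.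

HONEST FRAMING ∕ LIMITS.  MODEL: the AVERAGING summand of (3.26) is live (main term (125); one-level staircase contours; transporters component-blind only if `U` is); the LANDAU summand
`D_U R(U) D*_U` stays FLAT (`−∂Π∂* ⊗ 1_ι`; its covariant edition needs [B9] Thms 3.1–3.3 — N06's lane); global small-field gauge (per-cube gauges need the FULLY covariant `P(U)`);
doubled-torus cover; one grid (the η-defect `𝔇(N_V^Q′, N_V^Q)` and the node edition are the sequel).  NOT [B9] Thm 3.1 as printed; NE2⁺ NOT PRINTED; N15 of record untouched (DISCHARGED AS
CONSUMED, p687738); counts UNMOVED (typed 28∕28); one finite 𝕋⁴ at fixed ε per index — NOT infinite volume ∕ OS ∕ mass gap ∕ Clay.  Restate-immune (no Theses import).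
-/

noncomputable section

open scoped BigOperators Matrix

namespace Summit.QuantumFields.YangMills.BalabanUVNodes.N15.Gluing

open Real
open Literature.MathematicalPhysics.QuantumFieldTheory.Balaban1983to89
open Literature.MathematicalPhysics.QuantumFieldTheory.Balaban1983to89.B11SectG (BlockNorm HasMaj)
open Literature.MathematicalPhysics.QuantumFieldTheory.Balaban1983to89.B11AxialTransport190 (abs_le_loc_ofBlocks loc_ofBlocks_le)
open Literature.MathematicalPhysics.QuantumFieldTheory.Balaban1983to89.B6Prop26Gluing (mulOp mulOp_apply)
open Literature.MathematicalPhysics.QuantumFieldTheory.Balaban1983to89.B6UnitTorusCarrier (unitTorusGeo unitTorusGeo_dist_nonneg unitTorusGeo_dist)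
open Literature.MathematicalPhysics.QuantumFieldTheory.Balaban1983to89.B9Eq39Adjoint (covD fluct)
open Literature.MathematicalPhysics.QuantumFieldTheory.Balaban1983to89.B9Eq3117Current (gaugeTr)
open Literature.MathematicalPhysics.QuantumFieldTheory.King1986.Torus (blockOf tdistT)
open Literature.Barriers.QuantumFields (traceForm)
open Summit.QuantumFields.YangMills.BalabanUVNodes.N15.BackgroundLayer (covLapM tCoefA tCoefC)
open Summit.QuantumFields.YangMills.BalabanUVNodes.N15.VectorPiece (bshiftEquiv tensorId tensorId_apply)
open Summit.QuantumFields.YangMills.BalabanUVNodes.N15.MatrixSpecies (mmulOp coordMat basisConst basisConst_nonneg liftBlk)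
open Summit.QuantumFields.YangMills.BalabanUVNodes.N15.CurvedSpecies (gaugePair uN_opLetters_of_gauge335 uN_abs_coordMat_conj_sub_one_entry_le_op)
open Summit.QuantumFields.YangMills.BalabanUVNodes.N15.TwoGrid (qvRe qvAdjRe landauRe chiCube abs_chiCube_le_one)
open Summit.QuantumFields.YangMills.BalabanUVNodes.N15.CovAvg (qvCov qvCovAdj hasMaj_nvQ)

variable {d : ℕ}

/-! ## §1 The transporter datum, the averaging perturbation `N_V^Q`, the summand `N_L ⊗ 1 − N_V^Q` -/

section Objects

open scoped Matrix.Norms.L2Operator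

variable {mm : Type} [Fintype mm] [DecidableEq mm] {ι : Type} [Fintype ι] [DecidableEq ι]

/-- THE TRANSPORTER DATUM of a bond field `U`: the coordinate matrices `coordMat e Ad_{U_μ(p)}` of the one-bond transporters. [cite: Balaban1985BackgroundPropagators, (3.50) p.400 («R(U(b))»: shape)] -/
def cvT {X : Type} (e : Matrix mm mm ℂ ≃L[ℝ] (ι → ℝ)) (U : Fin (d + 1) → X → Matrix mm mm ℂ) : Fin (d + 1) → X → Matrix ι ι ℝ :=
  fun μ p => coordMat e (ContinuousLinearMap.mulLeftRight ℝ (Matrix mm mm ℂ) (U μ p) (U μ p)ᴴ)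

/-- At `U ≡ 1` the transporter datum is `1`. [folklore] -/
theorem cvT_one {X : Type} (e : Matrix mm mm ℂ ≃L[ℝ] (ι → ℝ)) : cvT (d := d) e (fun (_ : Fin (d + 1)) (_ : X) => (1 : Matrix mm mm ℂ)) = fun _ _ => 1 := by
  funext μ p
  simp only [cvT]
  exact CurvedSpecies.coordMat_conj_one e

variable (d) (L : ℕ) [NeZero L]

/-- ★ THE AVERAGING PERTURBATION `N_V^Q := a·(Q*Q ⊗ 1_ι − Q*(U)∘Q(U))` of the cover knit with Bałaban's covariant averaging summand live (`Q(U) = qvCov` of n15-c∕181 at the transporters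
`cvT e U`). [cite: Balaban1985BackgroundPropagators, (3.26) p.395, (3.59)–(3.60) p.402 (the averaging words: shape)] -/
def cvNVq (mv kk : ℕ) (hL : Odd L ∧ 1 < L) (a : ℝ) (ι : Type) [Fintype ι] [DecidableEq ι] (e : Matrix mm mm ℂ ≃L[ℝ] (ι → ℝ)) (U : Fin (d + 1) → CvX d L mv kk hL → Matrix mm mm ℂ) :
    (CvX d L mv kk hL × ι → ℝ) →ₗ[ℝ] (CvX d L mv kk hL × ι → ℝ) :=
  a • (tensorId ι (qvAdjRe (cvM d L mv kk hL) (L ^ kk) ∘ₗ qvRe (cvM d L mv kk hL) (L ^ kk)) -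
    qvCovAdj (cvM d L mv kk hL) (L ^ kk) (cvT e U) ∘ₗ qvCov (cvM d L mv kk hL) (L ^ kk) (cvT e U))

variable {d L}

/-- ★ **THE SUMMAND**: `N_L ⊗ 1_ι − N_V^Q = a·Q*(U)∘Q(U) + (−∂Π∂*) ⊗ 1_ι` — Bałaban's `P` with the AVERAGING summand covariant and live, the Landau summand flat.
[cite: Balaban1985BackgroundPropagators, (3.26) p.395; Balaban1984PropagatorsI, (1.69) p.29] -/
theorem cvNL_sub_cvNVq (mv kk : ℕ) (hL : Odd L ∧ 1 < L) (a : ℝ) (e : Matrix mm mm ℂ ≃L[ℝ] (ι → ℝ)) (U : Fin (d + 1) → CvX d L mv kk hL → Matrix mm mm ℂ) :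
    cvNL d L mv kk hL a ι - cvNVq d L mv kk hL a ι e U =
      a • (qvCovAdj (cvM d L mv kk hL) (L ^ kk) (cvT e U) ∘ₗ qvCov (cvM d L mv kk hL) (L ^ kk) (cvT e U)) + tensorId ι (-landauRe (cvM d L mv kk hL) (L ^ kk)) := by
  rw [cvNL, cvNVq, BackgroundLayer.tensorId_add, BackgroundLayer.tensorId_smul, smul_sub]
  abel

/-- 120's `hP` row at `w ≡ 1` for the summand `N_L ⊗ 1 − N_V^Q`: `M_W (N_L ⊗ 1 − N_V^Q) M_{Wᵀ} = N_L ⊗ 1 − N_V^Q`. [folklore] -/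
theorem conj_one_cvNL_sub_cvNVq (mv kk : ℕ) (hL : Odd L ∧ 1 < L) (a : ℝ) (e : Matrix mm mm ℂ ≃L[ℝ] (ι → ℝ)) (U : Fin (d + 1) → CvX d L mv kk hL → Matrix mm mm ℂ) :
    mmulOp (fun _ : CvX d L mv kk hL => coordMat e (ContinuousLinearMap.mulLeftRight ℝ (Matrix mm mm ℂ) (1 : Matrix mm mm ℂ) (1 : Matrix mm mm ℂ)ᴴ)) ∘ₗ
        (cvNL d L mv kk hL a ι - cvNVq d L mv kk hL a ι e U) ∘ₗ
        mmulOp (fun _ : CvX d L mv kk hL => (coordMat e (ContinuousLinearMap.mulLeftRight ℝ (Matrix mm mm ℂ) (1 : Matrix mm mm ℂ) (1 : Matrix mm mm ℂ)ᴴ))ᵀ) =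
      cvNL d L mv kk hL a ι - cvNVq d L mv kk hL a ι e U := by
  have h := conj_one_eq_sub_zero e (cvNL d L mv kk hL a ι - cvNVq d L mv kk hL a ι e U)
  rw [sub_zero] at h
  exact h

omit [Fintype ι] [DecidableEq ι] in
/-- BOUNDED DIAGONALS ON BOTH SIDES COST NOTHING: `|ψ|, |χ| ≤ 1` and `N ≤ K` (`K ≥ 0`) between the sharp block norms ⟹ `M_ψ ∘ N ∘ M_χ ≤ K`. [folklore] -/
theorem hasMaj_sandwich_of_abs_le_one {g : B6.Geometry} {Y : Type} [Fintype Y] (blk : Y → g.Site) {N : (Y → ℝ) →ₗ[ℝ] (Y → ℝ)} {K : g.Site → g.Site → ℝ}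
    {ψ χ : Y → ℝ} (hψ : ∀ p, |ψ p| ≤ 1) (hχ : ∀ p, |χ p| ≤ 1) (hK : ∀ y y', 0 ≤ K y y') (hN : HasMaj (BlockNorm.ofBlocks g blk) (BlockNorm.ofBlocks g blk) N K) :
    HasMaj (BlockNorm.ofBlocks g blk) (BlockNorm.ofBlocks g blk) (mulOp ψ ∘ₗ N ∘ₗ mulOp χ) K := by
  intro y' μ hμ y
  have hχμ : (BlockNorm.ofBlocks g blk).IsLoc y' (mulOp χ μ) := fun p hp => by
    change χ p * μ p = 0
    rw [hμ p hp, mul_zero]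
  have hloc : (BlockNorm.ofBlocks g blk).loc y' (mulOp χ μ) ≤ (BlockNorm.ofBlocks g blk).loc y' μ :=
    loc_ofBlocks_le blk _ ((BlockNorm.ofBlocks g blk).loc_nonneg y' μ) fun p hp => by
      rw [mulOp_apply, abs_mul]
      exact (mul_le_of_le_one_left (abs_nonneg _) (hχ p)).trans (abs_le_loc_ofBlocks blk μ hp)
  refine loc_ofBlocks_le blk _ (mul_nonneg (hK y y') ((BlockNorm.ofBlocks g blk).loc_nonneg y' μ)) fun p hp => ?_
  rw [LinearMap.comp_apply, LinearMap.comp_apply, mulOp_apply, abs_mul]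
  calc |ψ p| * |N (mulOp χ μ) p| ≤ 1 * |N (mulOp χ μ) p| := mul_le_mul_of_nonneg_right (hψ p) (abs_nonneg _)
    _ ≤ K y y' * (BlockNorm.ofBlocks g blk).loc y' (mulOp χ μ) := by rw [one_mul]; exact (abs_le_loc_ofBlocks blk _ hp).trans (hN y' _ hχμ y)
    _ ≤ K y y' * (BlockNorm.ofBlocks g blk).loc y' μ := mul_le_mul_of_nonneg_left hloc (hK y y')

end Objects

/-! ## §2 The transporters of `e^{iηA}` in the global small-field gauge are `ρ`-close to `1` in rows and columns -/

section TransporterLetters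

open scoped Matrix.Norms.L2Operator

variable {mm : Type} [Fintype mm] [DecidableEq mm] [Nonempty mm] {ι : Type} [Fintype ι] [DecidableEq ι] (e : Matrix mm mm ℂ ≃L[ℝ] (ι → ℝ))
variable {X J : Type} [Fintype J] (τ : J → X ≃ X)

omit [Fintype J] in
/-- The entry letter of the transporters in the global gauge: `|(coordMat e Ad_{e^{iηA_μ(p)}} − 1)_{ij}| ≤ κ_e·2√m·(√m·η(C∕ξ)e^{ηC∕ξ})` (dag-n15-w2's entry letter at `‖e^{iηA} − 1‖ ≤ η(C∕ξ)e^{ηC∕ξ}`,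
`uN_opLetters_of_gauge335` at `u ≡ 1`). [cite: Balaban1985BackgroundPropagators, (3.35) p.396, (3.50) p.400 (shapes)] -/
theorem sf_abs_transporter_sub_one_entry_le {η : ℝ} (hη : 0 < η) {ξ C : ℝ} {A : J → X → Matrix mm mm ℂ} (hA : ∀ μ x, (A μ x)ᴴ = A μ x)
    (hA1 : ∀ μ x, ‖A μ x‖ < C * ξ⁻¹) (hA2 : ∀ μ ν x, ‖((η : ℂ)⁻¹) • covD τ (fun _ _ => (1 : (Matrix mm mm ℂ)ˣ)) μ (A ν) x‖ < C * (ξ ^ 2)⁻¹) (μ : J) (p : X) (i j : ι) :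
    |(coordMat e (ContinuousLinearMap.mulLeftRight ℝ (Matrix mm mm ℂ) (fluct η A μ p : Matrix mm mm ℂ) (fluct η A μ p : Matrix mm mm ℂ)ᴴ) - 1) i j| ≤
      @basisConst ι _ (Matrix mm mm ℂ) Matrix.frobeniusNormedAddCommGroup Matrix.frobeniusNormedSpace e * (2 * Real.sqrt (Fintype.card mm)) *
        (Real.sqrt (Fintype.card mm) * (η * (C / ξ) * Real.exp (η * (C / ξ)))) := by
  have hU : ((fluct η A μ p : Matrix mm mm ℂ))ᴴ * (fluct η A μ p : Matrix mm mm ℂ) = 1 :=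
    Matrix.mem_unitaryGroup_iff'.mp (fluct_mem_unitaryGroup_of_isHermitian η hA μ p)
  obtain ⟨-, h1, -⟩ := uN_opLetters_of_gauge335 (T := τ) (fluct η A) (cube := Set.univ) hη (u := fun _ => 1) (A := A)
    (fun z _ => ⟨by rw [Units.val_one]; exact norm_one.le, by rw [inv_one, Units.val_one]; exact norm_one.le⟩)
    (fun μ z _ => gaugeTr_one τ (fluct η A) μ z) (fun μ z _ => hA1 μ z) (fun μ ν z _ => hA2 μ ν z)
  have h1' : ‖(fluct η A μ p : Matrix mm mm ℂ) - 1‖ ≤ η * (C / ξ) * Real.exp (η * (C / ξ)) := by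
    have h := h1 μ p (Set.mem_univ p)
    rwa [gaugeTr_one τ (fluct η A) μ p] at h
  refine (uN_abs_coordMat_conj_sub_one_entry_le_op e hU i j).trans ?_
  have hκ := @basisConst_nonneg ι _ (Matrix mm mm ℂ) Matrix.frobeniusNormedAddCommGroup Matrix.frobeniusNormedSpace e
  gcongr

/-- ★ ROWS of `cvT e (e^{iηA}) − 1` are `≤ ρ := |ι|·κ_e·2√m·(√m·η(C∕ξ)e^{ηC∕ξ})`. [cite: Balaban1985BackgroundPropagators, (3.35) p.396, (3.50) p.400 (shapes)] -/
theorem sf_rows_cvT_sub_one_le {η : ℝ} (hη : 0 < η) {ξ C : ℝ} {A : Fin (d + 1) → X → Matrix mm mm ℂ} (hA : ∀ μ x, (A μ x)ᴴ = A μ x)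
    (τ : Fin (d + 1) → X ≃ X) (hA1 : ∀ μ x, ‖A μ x‖ < C * ξ⁻¹) (hA2 : ∀ μ ν x, ‖((η : ℂ)⁻¹) • covD τ (fun _ _ => (1 : (Matrix mm mm ℂ)ˣ)) μ (A ν) x‖ < C * (ξ ^ 2)⁻¹)
    (μ : Fin (d + 1)) (p : X) (i : ι) :
    ∑ j, |(cvT e (fun μ x => (fluct η A μ x : Matrix mm mm ℂ)) μ p - 1) i j| ≤
      Fintype.card ι * (@basisConst ι _ (Matrix mm mm ℂ) Matrix.frobeniusNormedAddCommGroup Matrix.frobeniusNormedSpace e * (2 * Real.sqrt (Fintype.card mm)) *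
        (Real.sqrt (Fintype.card mm) * (η * (C / ξ) * Real.exp (η * (C / ξ))))) := by
  calc ∑ j, |(cvT e (fun μ x => (fluct η A μ x : Matrix mm mm ℂ)) μ p - 1) i j|
      = ∑ j, |(coordMat e (ContinuousLinearMap.mulLeftRight ℝ (Matrix mm mm ℂ) (fluct η A μ p : Matrix mm mm ℂ) (fluct η A μ p : Matrix mm mm ℂ)ᴴ) - 1) i j| := rfl
    _ ≤ ∑ _j : ι, @basisConst ι _ (Matrix mm mm ℂ) Matrix.frobeniusNormedAddCommGroup Matrix.frobeniusNormedSpace e * (2 * Real.sqrt (Fintype.card mm)) *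
          (Real.sqrt (Fintype.card mm) * (η * (C / ξ) * Real.exp (η * (C / ξ)))) :=
        Finset.sum_le_sum fun j _ => sf_abs_transporter_sub_one_entry_le e τ hη hA hA1 hA2 μ p i j
    _ = _ := by rw [Finset.sum_const, Finset.card_univ, nsmul_eq_mul]

/-- ★ COLUMNS of `cvT e (e^{iηA}) − 1` are `≤ ρ`. [cite: Balaban1985BackgroundPropagators, (3.35) p.396, (3.50) p.400 (shapes)] -/
theorem sf_cols_cvT_sub_one_le {η : ℝ} (hη : 0 < η) {ξ C : ℝ} {A : Fin (d + 1) → X → Matrix mm mm ℂ} (hA : ∀ μ x, (A μ x)ᴴ = A μ x)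
    (τ : Fin (d + 1) → X ≃ X) (hA1 : ∀ μ x, ‖A μ x‖ < C * ξ⁻¹) (hA2 : ∀ μ ν x, ‖((η : ℂ)⁻¹) • covD τ (fun _ _ => (1 : (Matrix mm mm ℂ)ˣ)) μ (A ν) x‖ < C * (ξ ^ 2)⁻¹)
    (μ : Fin (d + 1)) (p : X) (j : ι) :
    ∑ i, |(cvT e (fun μ x => (fluct η A μ x : Matrix mm mm ℂ)) μ p - 1) i j| ≤
      Fintype.card ι * (@basisConst ι _ (Matrix mm mm ℂ) Matrix.frobeniusNormedAddCommGroup Matrix.frobeniusNormedSpace e * (2 * Real.sqrt (Fintype.card mm)) *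
        (Real.sqrt (Fintype.card mm) * (η * (C / ξ) * Real.exp (η * (C / ξ))))) := by
  calc ∑ i, |(cvT e (fun μ x => (fluct η A μ x : Matrix mm mm ℂ)) μ p - 1) i j|
      = ∑ i, |(coordMat e (ContinuousLinearMap.mulLeftRight ℝ (Matrix mm mm ℂ) (fluct η A μ p : Matrix mm mm ℂ) (fluct η A μ p : Matrix mm mm ℂ)ᴴ) - 1) i j| := rfl
    _ ≤ ∑ _i : ι, @basisConst ι _ (Matrix mm mm ℂ) Matrix.frobeniusNormedAddCommGroup Matrix.frobeniusNormedSpace e * (2 * Real.sqrt (Fintype.card mm)) *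
          (Real.sqrt (Fintype.card mm) * (η * (C / ξ) * Real.exp (η * (C / ξ)))) :=
        Finset.sum_le_sum fun i _ => sf_abs_transporter_sub_one_entry_le e τ hη hA hA1 hA2 μ p i j
    _ = _ := by rw [Finset.sum_const, Finset.card_univ, nsmul_eq_mul]

end TransporterLetters

/-! ## §3 The knit at the cover with the covariant averaging summand live: every row produced -/

section Knit

open scoped Matrix.Norms.L2Operator

variable {L : ℕ} [NeZero L]

/-- ★★★ **THE LIVE-BACKGROUND KNIT AT THE COVER WITH BAŁABAN's COVARIANT AVERAGING SUMMAND LIVE** (FILE 120 `uN_cvGlued_spec` with `w ≡ 1`, `U := e^{iηA}`, `P := N_L ⊗ 1 − N_V^Q = a·Q*(U)Q(U) −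
∂Π∂* ⊗ 1_ι`, `N_V := N_V^Q`): for odd `L ≥ 7`, `a > 0`, a colour index `ι` there are `δ, w₀, R₀, R₁, B > 0` such that on every doubled torus `2L·L^m` of the cover (`k ≥ 1`, `L^m ≥ w₀`), for
trace-form coordinates `e` of `𝔲(m)` (`m ≥ 1`), EVERY HERMITIAN bond field `A` with the GLOBAL (3.35) letters `‖A_μ(x)‖ < C∕ξ`, `‖η⁻¹∇^η_μA_ν(x)‖ < C∕ξ²` (`η = L^{−k}`, `ξ > 0`, `C ≥ 0`) whose two
explicit row bounds are `≤ r_V`, whose transporter size `K = (1+ρ)^{(d+2)L^k} − 1` (`ρ = |ι|·κ_e·2√m·√m·η(C∕ξ)e^{ηC∕ξ}`) is `≤ 1`, and with `r_V(1 + |J ⊕ J|) + R₁K ≤ R₀`: the glued operator of the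
dressed smooth-cut Neumann cubes of the cover for the transporters `Ad_{e^{iηA}}` — gauges `1`, summand `a·Q*(U)Q(U) − ∂Π∂* ⊗ 1_ι`, perturbation `N_V^Q` — is `≤ B·e^{−(δ∕16)|y−y′|_T}` blockwise
AND is the two-sided inverse of `Δ_{Ad e^{iηA}} + a·Q*(U)Q(U) − ∂Π∂* ⊗ 1_ι`.  MODEL (averaging summand live, Landau summand flat; global gauge; doubled torus); NOT [B9] Thm 3.1 as printed.
[cite: Balaban1985BackgroundPropagators, Thm 3.1 p.397 (shape: «G(U) … for U satisfying (3.35), M ≥ M₁»), (3.26) p.395, (3.34)–(3.35) p.396, (3.50)–(3.52) p.400, (3.59)–(3.60) p.402; Balaban1985Averaging, (125)–(126) p.36; Balaban1984PropagatorsI, (1.69) p.29; Balaban1984PropagatorsII, (2.91)–(2.93) p.239] -/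
theorem sfq_cvGlued_spec (hL : Odd L ∧ 1 < L) (hL7 : 7 ≤ L) {a : ℝ} (ha : 0 < a) (ι : Type) [Fintype ι] [DecidableEq ι] :
    ∃ δ w₀ R₀ R₁ B : ℝ, 0 < δ ∧ 0 < R₀ ∧ 0 < R₁ ∧ 0 < B ∧
      ∀ (mv kk : ℕ), 1 ≤ kk → w₀ ≤ ((L ^ mv : ℕ) : ℝ) →
      ∀ {mm : Type} [Fintype mm] [DecidableEq mm] [Nonempty mm] (e : Matrix mm mm ℂ ≃L[ℝ] (ι → ℝ)), (∀ A B : Matrix mm mm ℂ, traceForm A B = e A ⬝ᵥ e B) →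
      ∀ (A : Fin (d + 1) → CvX d L mv kk hL → Matrix mm mm ℂ), (∀ μ x, (A μ x)ᴴ = A μ x) →
      ∀ (ξ C : ℝ), 0 < ξ → 0 ≤ C → (∀ μ x, ‖A μ x‖ < C * ξ⁻¹) →
        (∀ μ ν x, ‖((((((L ^ kk : ℕ) : ℝ))⁻¹) : ℝ) : ℂ)⁻¹ • covD (bshiftEquiv (cvM d L mv kk hL) (L ^ kk)) (fun _ _ => (1 : (Matrix mm mm ℂ)ˣ)) μ (A ν) x‖ < C * (ξ ^ 2)⁻¹) →
      ∀ (rV : ℝ), 0 ≤ rV →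
        Fintype.card ι * (@basisConst ι _ (Matrix mm mm ℂ) Matrix.frobeniusNormedAddCommGroup Matrix.frobeniusNormedSpace e * (2 * Real.sqrt (Fintype.card mm)) * (Real.sqrt (Fintype.card mm) * ((C / ξ) * Real.exp (((((L ^ kk : ℕ) : ℝ))⁻¹) * (C / ξ))))) ≤ rV →
        Fintype.card ι * (Fintype.card (Fin (d + 1)) * (Fintype.card ι * (@basisConst ι _ (Matrix mm mm ℂ) Matrix.frobeniusNormedAddCommGroup Matrix.frobeniusNormedSpace e * (2 * Real.sqrt (Fintype.card mm)) * (Real.sqrt (Fintype.card mm) * ((C / ξ) * Real.exp (((((L ^ kk : ℕ) : ℝ))⁻¹) * (C / ξ))))) ^ 2 + @basisConst ι _ (Matrix mm mm ℂ) Matrix.frobeniusNormedAddCommGroup Matrix.frobeniusNormedSpace e * (2 * Real.sqrt (Fintype.card mm)) * (Real.sqrt (Fintype.card mm) * ((C / ξ ^ 2) * Real.exp (((((L ^ kk : ℕ) : ℝ))⁻¹) * (C / ξ)))))) ≤ rV →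
        (1 + Fintype.card ι * (@basisConst ι _ (Matrix mm mm ℂ) Matrix.frobeniusNormedAddCommGroup Matrix.frobeniusNormedSpace e * (2 * Real.sqrt (Fintype.card mm)) * (Real.sqrt (Fintype.card mm) * (((((L ^ kk : ℕ) : ℝ))⁻¹) * (C / ξ) * Real.exp (((((L ^ kk : ℕ) : ℝ))⁻¹) * (C / ξ)))))) ^ ((d + 2) * L ^ kk) - 1 ≤ 1 →
        rV * (1 + Fintype.card (Fin (d + 1) ⊕ Fin (d + 1))) +
          R₁ * ((1 + Fintype.card ι * (@basisConst ι _ (Matrix mm mm ℂ) Matrix.frobeniusNormedAddCommGroup Matrix.frobeniusNormedSpace e * (2 * Real.sqrt (Fintype.card mm)) * (Real.sqrt (Fintype.card mm) * (((((L ^ kk : ℕ) : ℝ))⁻¹) * (C / ξ) * Real.exp (((((L ^ kk : ℕ) : ℝ))⁻¹) * (C / ξ)))))) ^ ((d + 2) * L ^ kk) - 1) ≤ R₀ →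
                HasMaj (CvNorm d L mv kk hL ι) (CvNorm d L mv kk hL ι) (cvGlued d L mv kk hL a ((((L ^ kk : ℕ) : ℝ))⁻¹) ι e (fun _ _ => (1 : Matrix mm mm ℂ)) (fun μ x => (fluct ((((L ^ kk : ℕ) : ℝ))⁻¹) A μ x : Matrix mm mm ℂ))
            (cvNL d L mv kk hL a ι - cvNVq d L mv kk hL a ι e (fun μ x => (fluct ((((L ^ kk : ℕ) : ℝ))⁻¹) A μ x : Matrix mm mm ℂ))) (fun _ => cvNVq d L mv kk hL a ι e (fun μ x => (fluct ((((L ^ kk : ℕ) : ℝ))⁻¹) A μ x : Matrix mm mm ℂ))))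
          (fun y y' => B * Real.exp (-(δ / 16 * (unitTorusGeo L kk (cvM d L mv kk hL)).dist y y'))) ∧
        (cvGlued d L mv kk hL a ((((L ^ kk : ℕ) : ℝ))⁻¹) ι e (fun _ _ => (1 : Matrix mm mm ℂ)) (fun μ x => (fluct ((((L ^ kk : ℕ) : ℝ))⁻¹) A μ x : Matrix mm mm ℂ))
            (cvNL d L mv kk hL a ι - cvNVq d L mv kk hL a ι e (fun μ x => (fluct ((((L ^ kk : ℕ) : ℝ))⁻¹) A μ x : Matrix mm mm ℂ))) (fun _ => cvNVq d L mv kk hL a ι e (fun μ x => (fluct ((((L ^ kk : ℕ) : ℝ))⁻¹) A μ x : Matrix mm mm ℂ))) ∘ₗ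
          (covLapM (bshiftEquiv (cvM d L mv kk hL) (L ^ kk)) ((((L ^ kk : ℕ) : ℝ))⁻¹) (gaugePair (bshiftEquiv (cvM d L mv kk hL) (L ^ kk)) (fun μ x => coordMat e (ContinuousLinearMap.mulLeftRight ℝ (Matrix mm mm ℂ) (fluct ((((L ^ kk : ℕ) : ℝ))⁻¹) A μ x : Matrix mm mm ℂ) (fluct ((((L ^ kk : ℕ) : ℝ))⁻¹) A μ x : Matrix mm mm ℂ)ᴴ))) +
            (cvNL d L mv kk hL a ι - cvNVq d L mv kk hL a ι e (fun μ x => (fluct ((((L ^ kk : ℕ) : ℝ))⁻¹) A μ x : Matrix mm mm ℂ)))) = LinearMap.id ∧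
          (covLapM (bshiftEquiv (cvM d L mv kk hL) (L ^ kk)) ((((L ^ kk : ℕ) : ℝ))⁻¹) (gaugePair (bshiftEquiv (cvM d L mv kk hL) (L ^ kk)) (fun μ x => coordMat e (ContinuousLinearMap.mulLeftRight ℝ (Matrix mm mm ℂ) (fluct ((((L ^ kk : ℕ) : ℝ))⁻¹) A μ x : Matrix mm mm ℂ) (fluct ((((L ^ kk : ℕ) : ℝ))⁻¹) A μ x : Matrix mm mm ℂ)ᴴ))) +
            (cvNL d L mv kk hL a ι - cvNVq d L mv kk hL a ι e (fun μ x => (fluct ((((L ^ kk : ℕ) : ℝ))⁻¹) A μ x : Matrix mm mm ℂ)))) ∘ₗ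
          cvGlued d L mv kk hL a ((((L ^ kk : ℕ) : ℝ))⁻¹) ι e (fun _ _ => (1 : Matrix mm mm ℂ)) (fun μ x => (fluct ((((L ^ kk : ℕ) : ℝ))⁻¹) A μ x : Matrix mm mm ℂ))
            (cvNL d L mv kk hL a ι - cvNVq d L mv kk hL a ι e (fun μ x => (fluct ((((L ^ kk : ℕ) : ℝ))⁻¹) A μ x : Matrix mm mm ℂ))) (fun _ => cvNVq d L mv kk hL a ι e (fun μ x => (fluct ((((L ^ kk : ℕ) : ℝ))⁻¹) A μ x : Matrix mm mm ℂ))) = LinearMap.id) := by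
  obtain ⟨δ, w₀, R₀, θ₀, B, hδ, hR₀, hθ₀, hB, H⟩ := uN_cvGlued_spec (d := d) hL hL7 ha ι
  -- the new constants: `R₀' = min R₀ θ₀`, `R₁ = 3|a|·c_{d+1}(δ)·e^{3δ} + 1`
  have hc0 : 0 ≤ B4Sect5Proof.latticeConst (d + 1) δ := B4Sect5Proof.latticeConst_nonneg (d + 1) hδ.le
  refine ⟨δ, w₀, min R₀ θ₀, 3 * |a| * (B4Sect5Proof.latticeConst (d + 1) δ * Real.exp (3 * δ)) + 1, B, hδ, lt_min hR₀ hθ₀, by positivity, hB, fun mv kk hk hw₀ => ?_⟩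
  intro mm _ _ _ e he A hA ξ C hξ hC hA1 hA2 rV hrV hrA hrC hK1 hRle
  have hη : (0 : ℝ) < ((((L ^ kk : ℕ) : ℝ))⁻¹) := inv_pos.mpr (Nat.cast_pos.mpr (pow_pos (Nat.pos_of_ne_zero (NeZero.ne L)) kk))
  have hlet := fun x => sf_localCoefLetters e (bshiftEquiv (cvM d L mv kk hL) (L ^ kk)) he hη hξ hC hA hA1 hA2 x
  -- the transporter letter `ρ` and its size `K`
  set ρ : ℝ := Fintype.card ι * (@basisConst ι _ (Matrix mm mm ℂ) Matrix.frobeniusNormedAddCommGroup Matrix.frobeniusNormedSpace e * (2 * Real.sqrt (Fintype.card mm)) *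
    (Real.sqrt (Fintype.card mm) * (((((L ^ kk : ℕ) : ℝ))⁻¹) * (C / ξ) * Real.exp (((((L ^ kk : ℕ) : ℝ))⁻¹) * (C / ξ))))) with hρdef
  set K : ℝ := (1 + ρ) ^ ((d + 2) * L ^ kk) - 1 with hKdef
  have hρ : 0 ≤ ρ := by
    have hκ := @basisConst_nonneg ι _ (Matrix mm mm ℂ) Matrix.frobeniusNormedAddCommGroup Matrix.frobeniusNormedSpace e
    have hCξ : 0 ≤ C / ξ := div_nonneg hC hξ.le
    rw [hρdef]; positivity
  have hK : 0 ≤ K := by have := one_le_pow₀ (M₀ := ℝ) (a := 1 + ρ) (by linarith) (n := (d + 2) * L ^ kk); rw [hKdef]; linarith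
  have hTr := sf_rows_cvT_sub_one_le (d := d) e hη hA (bshiftEquiv (cvM d L mv kk hL) (L ^ kk)) hA1 hA2
  have hTc := sf_cols_cvT_sub_one_le (d := d) e hη hA (bshiftEquiv (cvM d L mv kk hL) (L ^ kk)) hA1 hA2
  -- the letter of `N_V^Q` (n15-c∕182b) and its constant against `R₁K`
  have hNV := hasMaj_nvQ (L := L) (cvM d L mv kk hL) kk (L ^ kk) (T := cvT e (fun μ x => (fluct ((((L ^ kk : ℕ) : ℝ))⁻¹) A μ x : Matrix mm mm ℂ))) hρ hδ hTr hTc a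
  set R₁ : ℝ := 3 * |a| * (B4Sect5Proof.latticeConst (d + 1) δ * Real.exp (3 * δ)) + 1 with hR₁def
  have hconst : |a| * (K * (2 + K) * (B4Sect5Proof.latticeConst (d + 1) δ * Real.exp (3 * δ))) ≤ R₁ * K := by
    have h2K : K * (2 + K) ≤ 3 * K := by nlinarith
    have hce : 0 ≤ B4Sect5Proof.latticeConst (d + 1) δ * Real.exp (3 * δ) := mul_nonneg hc0 (Real.exp_nonneg _)
    rw [hR₁def]
    nlinarith [abs_nonneg a, mul_nonneg (abs_nonneg a) hce, mul_nonneg (mul_nonneg (abs_nonneg a) hce) hK]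
  have hNV' : HasMaj (CvNorm d L mv kk hL ι) (CvNorm d L mv kk hL ι) (cvNVq d L mv kk hL a ι e (fun μ x => (fluct ((((L ^ kk : ℕ) : ℝ))⁻¹) A μ x : Matrix mm mm ℂ)))
      (fun y y' => R₁ * K * Real.exp (-(δ * (unitTorusGeo L kk (cvM d L mv kk hL)).dist y y'))) := by
    refine hNV.mono fun y y' => ?_
    rw [unitTorusGeo_dist]
    exact mul_le_mul_of_nonneg_right hconst (Real.exp_nonneg _)
  have hRK0 : 0 ≤ R₁ * K := mul_nonneg (by rw [hR₁def]; positivity) hK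
  have hsand : ∀ (ψ χ : CvX d L mv kk hL → ℝ), (∀ x, |ψ x| ≤ 1) → (∀ x, |χ x| ≤ 1) →
      HasMaj (CvNorm d L mv kk hL ι) (CvNorm d L mv kk hL ι) (mulOp (fun p : CvX d L mv kk hL × ι => ψ p.1) ∘ₗ
        cvNVq d L mv kk hL a ι e (fun μ x => (fluct ((((L ^ kk : ℕ) : ℝ))⁻¹) A μ x : Matrix mm mm ℂ)) ∘ₗ mulOp (fun p : CvX d L mv kk hL × ι => χ p.1))
      (fun y y' => R₁ * K * Real.exp (-(δ * (unitTorusGeo L kk (cvM d L mv kk hL)).dist y y'))) := fun ψ χ hψ hχ => by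
    exact hasMaj_sandwich_of_abs_le_one (g := unitTorusGeo L kk (cvM d L mv kk hL)) (liftBlk (cvBlk d L mv kk hL) ι)
      (N := cvNVq d L mv kk hL a ι e (fun μ x => (fluct ((((L ^ kk : ℕ) : ℝ))⁻¹) A μ x : Matrix mm mm ℂ)))
      (K := fun y y' => R₁ * K * Real.exp (-(δ * (unitTorusGeo L kk (cvM d L mv kk hL)).dist y y')))
      (ψ := fun p : CvX d L mv kk hL × ι => ψ p.1) (χ := fun p : CvX d L mv kk hL × ι => χ p.1)
      (fun p => hψ p.1) (fun p => hχ p.1) (fun y y' => mul_nonneg hRK0 (Real.exp_nonneg _)) hNV'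
  have hRle' : rV * (1 + Fintype.card (Fin (d + 1) ⊕ Fin (d + 1))) + R₁ * K ≤ R₀ := hRle.trans (min_le_left _ _)
  have hθle : R₁ * K ≤ θ₀ := by
    have h0 : 0 ≤ rV * (1 + Fintype.card (Fin (d + 1) ⊕ Fin (d + 1))) := by positivity
    linarith [hRle.trans (min_le_right R₀ θ₀)]
  exact H mv kk hk hw₀ e he (fun _ _ => 1) (fun _ _ => by rw [Matrix.conjTranspose_one, Matrix.mul_one]) (fun μ x => (fluct ((((L ^ kk : ℕ) : ℝ))⁻¹) A μ x : Matrix mm mm ℂ))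
    (cvNL d L mv kk hL a ι - cvNVq d L mv kk hL a ι e (fun μ x => (fluct ((((L ^ kk : ℕ) : ℝ))⁻¹) A μ x : Matrix mm mm ℂ)))
    (fun _ => cvNVq d L mv kk hL a ι e (fun μ x => (fluct ((((L ^ kk : ℕ) : ℝ))⁻¹) A μ x : Matrix mm mm ℂ))) rV (R₁ * K) (R₁ * K) hrV hRK0 hRK0 hRle' hθle
    (fun k => conj_one_cvNL_sub_cvNVq mv kk hL a e _)
    (fun k x _ i => ((hlet x).2 i).trans hrC) (fun k j' x _ i => ((hlet x).1 j' i).trans hrA)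
    (fun k => hsand _ _ (fun x => abs_chiCube_le_one _ x) (fun x => abs_chiCube_le_one _ x))
    (fun k => by
      have hψ : ∀ x : CvX d L mv kk hL, |(1 - cvPsi d L mv kk hL k) x| ≤ 1 := fun x => by
        rw [Pi.sub_apply, Pi.one_apply]
        unfold cvPsi chiCube
        split_ifs <;> simp
      have h := hsand (1 - cvPsi d L mv kk hL k) (cvChi d L mv kk hL k) hψ (fun x => abs_chiCube_le_one _ x)
      have hid : (LinearMap.id - mulOp (fun p : CvX d L mv kk hL × ι => cvPsi d L mv kk hL k p.1)) =
          mulOp (fun p : CvX d L mv kk hL × ι => (1 - cvPsi d L mv kk hL k) p.1) :=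
        LinearMap.ext fun f => funext fun p => by simp [mulOp_apply, sub_mul]
      rw [hid]
      exact h)

end Knit

end Summit.QuantumFields.YangMills.BalabanUVNodes.N15.Gluing

end
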